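import Literature.Computability.MetaComplexity.Frege
import HarnessLib

/-!
# Soundness of extended Frege (Cook–Reckhow 1979, Prop. 4.2) and the status of `IsEFPolyBounded`

Sibling file of `Frege.lean` (which defines extended-Frege derivations `FregeSystem.IsEFDerivation`,
proofs `FregeSystem.IsEFProofOf` and polynomial boundedness `FregeSystem.IsEFPolyBounded` of
extended Frege over a rule list `F`). It proves

* `FregeSystem.IsSound.exists_eval_of_isEFDerivation`,
  `FregeSystem.IsSound.isTautology_of_isEFProofOf` — **soundness of extended Frege**
  (Cook–Reckhow 1979, Prop. 4.2, for proofs, i.e. derivations without hypotheses, which is the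
  setting of `IsEFDerivation`): over a sound rule list every `EF`-provable formula is a
  tautology. Printed proof (verbatim): "Let `τ` be any truth assignment … Then `τ` can be
  extended to make each line in the derivation true. In particular, if `P ≡ A` is a defining
  formula, then `P` has not occurred earlier in the derivation, so we are free to extend `τ` so
  `τ(P) = τ(A)`. Hence `τ(B)` is true, since `B` is the last line of the derivation." Here:
  by induction on prefixes of the derivation we build `τ'` with `φ.eval τ' = φ.eval τ` making
  every earlier line true; an inferred line is true by soundness of the rule instance
  (`FregeRule.IsSound.eval_subst`), and at an extension axiom `p ↔ ψ` we update `τ'` at the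
  fresh `p` to the value of `ψ`, which changes neither `ψ`, nor the earlier lines, nor `φ`
  (`PropForm.eval_update_of_not_mem_vars`), exactly the three freshness conditions of
  `FregeSystem.IsExtensionAxiom` (Cook–Reckhow Def. 4.1; Krajíček 1995, Def. 4.5.2).
* `FregeSystem.isEFProvable_iff_isTautology` — over a Frege system, `EF`-provability coincides
  with being a tautology (Prop. 4.2 with the completeness half of `IsFrege`, since a Frege proof
  is an `EF`-proof, `IsProofOf.isEFProofOf`).
* `FregeSystem.IsExtensionAxiom.ne_target`, `FregeSystem.not_isEFProofOf_of_rules_eq_nil`,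
  `FregeSystem.not_isEFPolyBounded_of_rules_eq_nil`, `FregeSystem.not_forall_isEFPolyBounded` —
  the rule-less list `⟨[]⟩` has no `EF`-proofs at all (every line would be an extension axiom
  `p ↔ ψ` with `p ∉ vars φ`, so the target `φ` is never a line), hence is not `EF`-polynomially
  bounded.

## Status of `FregeSystem.IsEFPolyBounded` (why there is no `IsEFPolyBounded_holds`)

`FregeSystem.IsEFPolyBounded : FregeSystem → Prop` is a *definition* — Cook–Reckhow's
"polynomially bounded" (1979, Def. 1.3) applied to the extended Frege system `eF` of Def. 4.1,
with size measured by symbol count — not a theorem of the source. Its universal closure over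
rule lists is false (`not_forall_isEFPolyBounded`). For a genuine Frege system `F` the
proposition `F.IsEFPolyBounded` is the negation of the open problem **pnp.S32**
(`Literature.Computability.Complexity.EFNotPolyBounded`, `ProofComplexity.lean`; robustness in
`F` is Cook–Reckhow Cor. 4.7, in the tree `efNotPolyBounded_iff_textbookFrege_holds`), and the
source conjectures it to be *false*: "the motivating question of this paper: Are any
conventional propositional proof systems polynomially bounded? We cannot answer that question
directly … We conjecture that the answer is always no" (1979, §1). By Prop. 4.2 (this file) and
Cook–Reckhow's Prop. 1.1/1.4 a positive instance would give `NP = coNP`. So the definition is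
neither dischargeable nor refutable for Frege `F` with present knowledge; nothing here alters it.

## Sources

* S. A. Cook, R. A. Reckhow, *The relative efficiency of propositional proof systems*,
  J. Symbolic Logic 44 (1979) 36–50: §1 (Def. 1.3, polynomially bounded; the conjecture quoted
  above), §4, Def. 4.1 (extended Frege), Prop. 4.2 (soundness of `eF`, with its proof),
  Cor. 4.7.
* J. Krajíček, *Bounded arithmetic, propositional logic, and complexity theory* (CUP 1995),
  Def. 4.5.2 (extended Frege), §4.5.

## Design notes / not here

* Only `Frege.lean` is imported: the two syntactic helper lemmas are proved here rather than
  taken from heavier files (`PropForm.eval_congr_vars` of `EFScaffold.lean` is not needed; the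
  update form `PropForm.eval_update_of_not_mem_vars` is what the printed proof uses).
* Not here: Prop. 4.3 (eliminating extension axioms at the cost of formula size), Thm. 4.5/4.6
  and the abstract-layer statement that `eF` is a Cook–Reckhow proof system for `TAUT`
  (needs a polynomial-time verifier for `IsEFProofOf`, cf. `FregeVerifierMachine.lean` for the
  Frege case).
-/

namespace Literature.Computability.Complexity.PropForm

universe u

variable {ν : Type u}

/-- Changing an assignment at a variable that does not occur in `φ` does not change the truth
value of `φ` — the step "we are free to extend `τ` so `τ(P) = τ(A)`" in the proof of
Cook–Reckhow's Prop. 4.2. (Dot-extension of `Literature.Computability.Complexity.PropForm`.)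
[folklore] -/
theorem eval_update_of_not_mem_vars [DecidableEq ν] {φ : PropForm ν} {x : ν} (hx : x ∉ φ.vars)
    (τ : ν → Bool) (b : Bool) : φ.eval (Function.update τ x b) = φ.eval τ := by
  induction φ with
  | var y =>
    have hxy : y ≠ x := fun h => hx (by simp [vars, h])
    simp [eval, Function.update_of_ne hxy]
  | const c => rfl
  | neg φ ih => simp only [eval, ih (by simpa [vars] using hx)]
  | conj φ ψ ihφ ihψ =>
    simp only [vars, Finset.mem_union, not_or] at hx
    simp only [eval, ihφ hx.1, ihψ hx.2]
  | disj φ ψ ihφ ihψ =>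
    simp only [vars, Finset.mem_union, not_or] at hx
    simp only [eval, ihφ hx.1, ihψ hx.2]

/-- The defined variable `p` occurs in the extension axiom `p ↔ ψ` (`PropForm.biimp (var p) ψ`).
(Dot-extension of `Literature.Computability.Complexity.PropForm`.) [folklore] -/
theorem mem_vars_biimp_var (p : ℕ) (ψ : PropForm ℕ) : p ∈ (biimp (var p) ψ).vars := by
  simp [biimp, vars]

end Literature.Computability.Complexity.PropForm

namespace Literature.Computability.MetaComplexity

open Complexity Complexity.PropForm

namespace FregeSystem

variable {F : FregeSystem} {π prev : List (PropForm ℕ)} {φ θ : PropForm ℕ}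

/-- **Soundness of extended Frege, assignment form** (Cook–Reckhow 1979, Prop. 4.2 and its
proof: "`τ` can be extended to make each line in the derivation true"). If the rules of `F` are
sound and `π` is an `EF`-derivation relative to the target formula `φ`, then every truth
assignment `τ` can be modified, without changing the truth value of `φ`, to an assignment
under which every line of `π` is true (the modification sets each defined variable `p` of an
extension axiom `p ↔ ψ` to the value of `ψ`). [cite: CookReckhow1979, Prop. 4.2] -/
theorem IsSound.exists_eval_of_isEFDerivation (hF : F.IsSound) (h : F.IsEFDerivation φ π)
    (τ : ℕ → Bool) :
    ∃ τ' : ℕ → Bool, φ.eval τ' = φ.eval τ ∧ ∀ θ ∈ π, θ.eval τ' = true := by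
  -- induction on prefixes: the first `k` lines can be made true without changing `φ`
  suffices H : ∀ k ≤ π.length, ∃ τ' : ℕ → Bool, φ.eval τ' = φ.eval τ ∧
      ∀ (j : ℕ) (hj : j < π.length), j < k → π[j].eval τ' = true by
    obtain ⟨τ', hφ, hπ⟩ := H π.length le_rfl
    refine ⟨τ', hφ, fun θ hθ => ?_⟩
    obtain ⟨j, hj, rfl⟩ := List.getElem_of_mem hθ
    exact hπ j hj hj
  intro k
  induction k with
  | zero => exact fun _ => ⟨τ, rfl, fun j _ hj => absurd hj (Nat.not_lt_zero j)⟩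
  | succ k ih =>
    intro hk
    obtain ⟨τ₁, hφ₁, hπ₁⟩ := ih (Nat.le_of_succ_le hk)
    have hk' : k < π.length := hk
    -- the earlier lines `π.take k` are true under `τ₁`
    have hprev : ∀ χ ∈ π.take k, χ.eval τ₁ = true := by
      intro χ hχ
      obtain ⟨j, hj, rfl⟩ := List.getElem_of_mem hχ
      rw [List.length_take] at hj
      rw [List.getElem_take]
      exact hπ₁ j (by omega) (by omega)
    rcases h k hk' with ⟨r, hr, σ, hconc, hprem⟩ | ⟨p, ψ, hθ, hpψ, hpφ, hpπ⟩
    · -- an inferred line is true under `τ₁` by soundness of the rule instance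
      refine ⟨τ₁, hφ₁, fun j hj hjk => ?_⟩
      by_cases hjk' : j < k
      · exact hπ₁ j hj hjk'
      · obtain rfl : j = k := by omega
        rw [← hconc]
        exact (hF r hr).eval_subst σ τ₁ fun q hq => hprev _ (hprem q hq)
    · -- an extension axiom `p ↔ ψ` with `p` fresh: set the value of `p` to that of `ψ`
      refine ⟨Function.update τ₁ p (ψ.eval τ₁), ?_, fun j hj hjk => ?_⟩
      · rw [eval_update_of_not_mem_vars hpφ, hφ₁]
      · by_cases hjk' : j < k
        · -- earlier lines do not contain `p`
          have hjt : j < (π.take k).length := by rw [List.length_take]; omega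
          have hmem : π[j] ∈ π.take k := by
            have hm := List.getElem_mem hjt
            rwa [List.getElem_take] at hm
          rw [eval_update_of_not_mem_vars (hpπ _ hmem)]
          exact hπ₁ j hj hjk'
        · obtain rfl : j = k := by omega
          rw [hθ, eval_biimp, eval_update_of_not_mem_vars hpψ]
          simp [eval]

/-- **Soundness of extended Frege** (Cook–Reckhow 1979, Prop. 4.2: "If `A₁, …, Aₙ ⊢_{eF} B`,
then `A₁, …, Aₙ ⊨ B`", here for proofs, `n = 0`): a formula with an extended-Frege proof over a
sound rule list is a tautology. [cite: CookReckhow1979, Prop. 4.2] -/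
theorem IsSound.isTautology_of_isEFProofOf (hF : F.IsSound) (h : F.IsEFProofOf π φ) :
    φ.IsTautology := by
  intro τ
  obtain ⟨τ', hφ, hπ⟩ := hF.exists_eval_of_isEFDerivation h.1 τ
  rw [← hφ]
  exact hπ φ (List.mem_of_getLast? h.2)

/-- Contrapositive of Prop. 4.2: a non-tautology has no extended-Frege proof over a sound rule
list. [cite: CookReckhow1979, Prop. 4.2] -/
theorem IsSound.not_isEFProofOf_of_not_isTautology (hF : F.IsSound) (h : ¬ φ.IsTautology) :
    ¬ F.IsEFProofOf π φ :=
  fun hπ => h (hF.isTautology_of_isEFProofOf hπ)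

/-- Over a Frege system, extended-Frege provability coincides with being a tautology: soundness
is Prop. 4.2, completeness is that of `F` itself (a Frege proof is an `EF`-proof,
`IsProofOf.isEFProofOf`). [cite: CookReckhow1979, Prop. 4.2] -/
theorem isEFProvable_iff_isTautology (hF : IsFrege F) :
    (∃ π, F.IsEFProofOf π φ) ↔ φ.IsTautology :=
  ⟨fun ⟨_, hπ⟩ => hF.1.isTautology_of_isEFProofOf hπ,
    fun h => ((provable_iff_isTautology hF).2 h).imp fun _ hπ => hπ.isEFProofOf⟩

/-! ### The rule-less list: `IsEFPolyBounded` is a genuine condition on `F` -/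

/-- An extension axiom admissible relative to the target `φ` is never `φ` itself: its defined
variable does not occur in `φ` (Cook–Reckhow 1979, Def. 4.1: "`P` can occur in later lines, but
not in the last line"). [cite: CookReckhow1979, Def. 4.1] -/
theorem IsExtensionAxiom.ne_target (h : IsExtensionAxiom φ prev θ) : θ ≠ φ := by
  obtain ⟨p, ψ, rfl, -, hpφ, -⟩ := h
  intro hθ
  exact hpφ (hθ ▸ mem_vars_biimp_var p ψ)

/-- Over the empty rule list nothing is `EF`-provable: no line is inferred, so every line is an
extension axiom, and the target is never an extension axiom (`IsExtensionAxiom.ne_target`).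
[folklore] -/
theorem not_isEFProofOf_of_rules_eq_nil (hF : F.rules = []) : ¬ F.IsEFProofOf π φ := by
  rintro ⟨hπ, hlast⟩
  obtain ⟨k, hk, hkφ⟩ := List.getElem_of_mem (List.mem_of_getLast? hlast)
  rcases hπ k hk with ⟨r, hr, -⟩ | hext
  · simp [hF] at hr
  · exact hext.ne_target hkφ

/-- Hence extended Frege over the empty rule list is not polynomially bounded (the tautology
`⊤` has no `EF`-proof). [folklore] -/
theorem not_isEFPolyBounded_of_rules_eq_nil (hF : F.rules = []) : ¬ F.IsEFPolyBounded := by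
  rintro ⟨p, hp⟩
  obtain ⟨π, hπ, -⟩ := hp (PropForm.const true) (fun _ => rfl)
  exact not_isEFProofOf_of_rules_eq_nil hF hπ

/-- `FregeSystem.IsEFPolyBounded` is a genuine condition on the rule list, not a theorem about
all of them: its universal closure fails at `⟨[]⟩`. (For Frege systems it is the negation of the
open problem `Literature.Computability.Complexity.EFNotPolyBounded`, pnp.S32.) [folklore] -/
theorem not_forall_isEFPolyBounded : ¬ ∀ F : FregeSystem, F.IsEFPolyBounded :=
  fun h => not_isEFPolyBounded_of_rules_eq_nil (F := ⟨[]⟩) rfl (h _)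

end FregeSystem

end Literature.Computability.MetaComplexity
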